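import Literature.AlgebraicGeometry.Resolution.SyzygyStaircase
import Literature.AlgebraicGeometry.Resolution.PresentationExt
import HarnessLib

/-!
# The `Ext`-annihilator ideals do not depend on the free resolution

Topic: `Literature/AlgebraicGeometry/Resolution`. The modules `E^q(F) = K_q^*/B^q` of
`SyzygyStaircase.lean` are built from a chosen free resolution of finite type `F` of `M`; here we
prove that their ANNIHILATORS (the ingredients of the `Ext`-annihilator ideal
`𝔠 = ∏ Ann E^q`, `ExtAnnihilatorAffineGlobal.lean`) depend only on `M`:

* `FreeResolution.syzygyObj_stablyEquiv` — **syzygies are unique up to free summands**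
  (iterated Schanuel): `K_q(F) × R^a ≃ K_q(F') × R^b` for some `a, b`;
* `FreeResolution.EMod_succ_eq` — `E^{q+1}(F)` is literally `PresExt.E (j_q)` for the syzygy
  presentation `0 → K_{q+1} → F_q → K_q → 0`;
* `FreeResolution.annihilator_EMod_eq` — **`Ann E^q(F) = Ann E^q(F')`** for any two free
  resolutions of finite type of `M` (`PresExt.annihilator_eq_of_linearEquiv` +
  `annihilator_E_inl_comp`), and `prod_annihilator_EMod_eq` for the products over index windows.

[cite: Matsumura1987, §19 Lemma 3 (Schanuel), Lemma 4 (generalised Schanuel lemma);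
Appendix B, p. 282 ("Ext … does not depend on the choice of P")]
-/

noncomputable section

open Module

universe u

namespace Literature.AlgebraicGeometry.Resolution

namespace FreeResolution

variable {R : Type u} [CommRing R] {M : Type u} [AddCommGroup M] [Module R M]
variable (F F' : FreeResolution R M)

/-- **Syzygies are stably unique** (iterated Schanuel): for two free resolutions of finite type
of `M` and every `q` there are `a, b` with `K_q(F) × R^a ≃ K_q(F') × R^b`.
[cite: Matsumura1987, §19 Lemma 4 (generalised Schanuel lemma)] -/
theorem syzygyObj_stablyEquiv : ∀ q : ℕ, ∃ a b : ℕ,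
    Nonempty ((F.syzygyObj q × (Fin a → R)) ≃ₗ[R] (F'.syzygyObj q × (Fin b → R)))
  | 0 => ⟨0, 0, ⟨LinearEquiv.refl R _⟩⟩
  | q + 1 => by
    obtain ⟨a, b, ⟨e⟩⟩ := syzygyObj_stablyEquiv q
    obtain ⟨h1, h2, h3⟩ := PresExt.presentation_prod (G := Fin a → R) (F.syzygyι q).hom
      (F.coverπ q).hom (F.syzygyι_injective q) (F.range_syzygyι q) (F.coverπ_surjective q)
    obtain ⟨h1', h2', h3'⟩ := PresExt.presentation_prod (G := Fin b → R) (F'.syzygyι q).hom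
      (F'.coverπ q).hom (F'.syzygyι_injective q) (F'.range_syzygyι q) (F'.coverπ_surjective q)
    obtain ⟨Φ⟩ := PresExt.schanuel _ _ _ _ h1 h2 h3 h1' h2' h3' e
    -- `K_{q+1} × (F'_q × R^b) ≃ K'_{q+1} × (F_q × R^a)`; flatten the free parts
    refine ⟨F'.rank q + b, F.rank q + a, ⟨?_⟩⟩
    exact ((LinearEquiv.refl R _).prodCongr (finArrowProdEquiv (F'.rank q) b).symm).trans
      (Φ.trans ((LinearEquiv.refl R _).prodCongr (finArrowProdEquiv (F.rank q) a)))

/-- `E^{q+1}(F) = PresExt.E (j_q)` (definitionally). [folklore] -/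
theorem EMod_succ_eq (q : ℕ) : F.EMod (q + 1) = PresExt.E (F.syzygyι q).hom := rfl

/-- **The annihilators of `E^q` do not depend on the resolution.**
[cite: Matsumura1987, Appendix B, p. 282] -/
theorem annihilator_EMod_eq : ∀ q : ℕ,
    Module.annihilator R (F.EMod q) = Module.annihilator R (F'.EMod q)
  | 0 => rfl
  | q + 1 => by
    obtain ⟨a, b, ⟨e⟩⟩ := F.syzygyObj_stablyEquiv F' q
    obtain ⟨h1, h2, h3⟩ := PresExt.presentation_prod (G := Fin a → R) (F.syzygyι q).hom
      (F.coverπ q).hom (F.syzygyι_injective q) (F.range_syzygyι q) (F.coverπ_surjective q)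
    obtain ⟨h1', h2', h3'⟩ := PresExt.presentation_prod (G := Fin b → R) (F'.syzygyι q).hom
      (F'.coverπ q).hom (F'.syzygyι_injective q) (F'.range_syzygyι q) (F'.coverπ_surjective q)
    change Module.annihilator R (PresExt.E (F.syzygyι q).hom) =
      Module.annihilator R (PresExt.E (F'.syzygyι q).hom)
    rw [← PresExt.annihilator_E_inl_comp (G := Fin a → R) (F.syzygyι q).hom,
      ← PresExt.annihilator_E_inl_comp (G := Fin b → R) (F'.syzygyι q).hom]
    exact PresExt.annihilator_eq_of_linearEquiv _ _ h1 h2 h3 _ _ h1' h2' h3' e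

/-- The `Ext`-annihilator products over any index set do not depend on the resolution.
[cite: Matsumura1987, Appendix B, p. 282] -/
theorem prod_annihilator_EMod_eq (T : Finset ℕ) :
    (∏ q ∈ T, Module.annihilator R (F.EMod q)) = ∏ q ∈ T, Module.annihilator R (F'.EMod q) :=
  Finset.prod_congr rfl fun q _ => F.annihilator_EMod_eq F' q

end FreeResolution

end Literature.AlgebraicGeometry.Resolution

end
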